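import Literature.RepresentationTheory.MoeglinVignerasWaldspurger1987.RankOneThetaLiftTwistRigiditySplit
import Literature.RepresentationTheory.MoeglinVignerasWaldspurger1987.RankOneThetaLiftLinesSplitPlace
import Literature.RepresentationTheory.MoeglinVignerasWaldspurger1987.RankOneThetaLiftSeparation
import Literature.NumberTheory.Automorphic.Liu2021.LemD1LocalInjectivity
import HarnessLib

/-!
# Rank-one theta lifts to `U(3)` at a SPLIT place: isomorphic lifts over two skew-hermitian lines have LINE-TRANSPORTED
# splittings and equal centre characters — [Liu2021, Lem. D.1 (3)] «⇒», split case, CONDITIONAL on row IV-4c4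

Topic `RepresentationTheory/MoeglinVignerasWaldspurger1987`; the SPLIT-PLACE twin of `RankOneThetaLiftSeparation.lean` §3
(`rankOne_theta_sameClass_and_char_eq_of_areIsomorphicRep`, non-split places, conditional on IV-4c1), in the same SECTION
currency at `N = 3`: ONE model `LocalMp F 3 T v`, sections `sᵢ : U(J)(F_v) →* LocalMp F 3 T v` over the embeddings
`ι_{δᵢ} = iota F E c 3 hcδᵢ hδᵢ hdᵢ T hT hJ v` of TWO skew-hermitian lines `δ₁, δ₂`, `ω_s = (MpPsi.toRep (localSchrodinger F 3 T v)).comp s`,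
`Θ_s(χ) = TwistedCoinv.rep χ ω_s _` (coinvariants under the centre `U(J₁)(F_v) = E_v¹`).  THEOREMS ONLY (no definition, no
named fact, debt Δ 0); the named fact `rankOne_theta_twist_rigidity_split` (row IV-4c4, p598433) enters as a HYPOTHESIS `h4`.

At a place `v` of `F` SPLIT in `E` (`¬ IsField (E ⊗_F F_v)`):
* every two lines are in one class — `δ₁ ⊗ 1 = x xᶜ (δ₂ ⊗ 1)` for a unit `x ∈ E_vˣ` (`exists_norm_mul_of_not_isField`,
  `RankOneThetaLiftLinesSplitPlace.lean`), so the LINE TRANSPORT of `RankOneThetaLiftLinesEquivalent.lean` moves a section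
  `s₂` over `ι_{δ₂}` to the section `lineTransportSplitting … x … s₂ = q_x s₂ q_x⁻¹` over `ι_{δ₁}`, with isomorphic theta
  lifts, the same non-vanishing, smoothness and `L²`-isometry (`proj_/isSmooth_/isL2Isometric_lineTransportSplitting`,
  `areIsomorphicRep_theta_lineTransportSplitting`);
* row IV-4c4 then applies to `s₁` and the transported `s₂` (same line `δ₁`): they are EQUAL.

* §1 `rankOne_theta_split_exists_lineTransportSplitting_eq_of_areIsomorphicRep` — under `h4`, at a split `v`, for unitary
  (`IsL2Isometric`) smooth sections `s₁/ι_{δ₁}`, `s₂/ι_{δ₂}` and unitary continuous `χ₁, χ₂` with `Θ_{s₁}(χ₁) ≠ 0` and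
  `Θ_{s₁}(χ₁) ≅ Θ_{s₂}(χ₂)`: `∃ x (hx : δ₁ ⊗ 1 = x xᶜ (δ₂ ⊗ 1)), lineTransportSplitting … x … s₂ = s₁`;
* §2 `rankOne_theta_split_lineTransport_eq_and_char_eq_of_areIsomorphicRep` — the same ∧ `χ₁ = χ₂` (the `χ`-half is
  the unconditional `rankOne_thetaChar_eq_of_areIsomorphicRep₂`, any place);
* §0 `exists_conj_eq_of_lineTransportSplitting_eq` — reading a line-transport equality as conjugacy inside `LocalMp F N T v`:
  `s₁ g = q * s₂ g * q⁻¹` for ONE `q` (the lift `q_x`), the form in which the `μ`-clause consumer («equal sections up to the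
  transport ⇒ equal `μ_v`», Kudla's explicit splittings) reads it.

AS PRINTED this is [Liu2021, App. D Lem. D.1 (3)] (l. 5233) «⇒» at a split place, proof l. 5249–5254 («We consider first
the case where `E = F × F` … The lemma follows from such description» = [Minguez2008, Thm. 1]); here only the REDUCTION
to the one-line statement IV-4c4 is proved.  Written for the cell `hodgecm-mathlib`, skeleton `a4-liuD3` stub
`stub_splitInjective` (the `μ ∧ χ` third at split places): what remains for that stub after this file is the MODEL
TRANSPORT from the indexed family to section currency, the unitarity/non-vanishing binders, and «transported-equal
χ-splittings ⇒ equal `μ_v`».  HC_CM is NOT proved here; nothing beyond the cited statements is asserted.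

## References
* [Liu2021] Y. Liu, Camb. J. Math. 9 (2021) = arXiv:2102.11518 — App. D Lem. D.1 (3) (l. 5233), proof, split case
  (l. 5249–5254; chunk p0056 L32).
* [Minguez2008] A. Mínguez, Ann. Sci. ÉNS 41 (2008) 717–741 — Thm. 1 p. 718 (type II theta `(GL_1, GL_n)`).
* [MoeglinVignerasWaldspurger1987] MVW, LNM 1291, Chap. 2 II.1 (A)–(B) (implementers, conjugate sections), Chap. 3 IV.
-/

noncomputable section

namespace Literature.RepresentationTheory.MoeglinVignerasWaldspurger1987

open NumberField IsDedekindDomain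
open scoped Matrix
open _root_.MeasureTheory
open Literature.RepresentationTheory.HeisenbergGroup (MpPsi)
open Literature.NumberTheory.GelbartRogawski1991.UnitaryDualPair.LocalSplitting (iota LocalMp localSchrodinger)
open Literature.NumberTheory.Automorphic (SchwartzBruhat UnitaryGroup.localPi UnitaryGroup.localCenter UnitaryGroup.LocalRing
  UnitaryGroup.localCenter_comm)
open Literature.NumberTheory.Automorphic.UnitaryGroup (LocalRing conjLocal)
open Literature.NumberTheory.Automorphic.Liu2021 (AreIsomorphicRep)

/-! ## §0 A line-transport equality is a conjugacy inside `LocalMp F N T v` -/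

section Conj

variable {F : Type} [Field F] [NumberField F] (E : Type) [Field E] [NumberField E] [Algebra F E]
  [Algebra.IsQuadraticExtension F E] (v : HeightOneSpectrum (𝓞 F)) (c : E ≃ₐ[F] E) (N : ℕ)
  {δ₁ δ₂ : E} (hcδ₁ : c δ₁ = -δ₁) (hδ₁ : δ₁ ≠ 0) {d₁ : F} (hd₁ : δ₁ * δ₁ = algebraMap F E d₁)
  (hcδ₂ : c δ₂ = -δ₂) (hδ₂ : δ₂ ≠ 0) {d₂ : F} (hd₂ : δ₂ * δ₂ = algebraMap F E d₂) (x : (LocalRing E v)ˣ)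
  (T : Matrix (Fin N) (Fin N) F) (hT : T.IsSymm) (hTd : IsUnit T.det) {J : Matrix (Fin N) (Fin N) E}
  (hx : algebraMap E (LocalRing E v) δ₂ = (x : LocalRing E v) * conjLocal E c v x * algebraMap E (LocalRing E v) δ₁)

/-- **a line-transport equality `lineTransportSplitting … x … s₁ = s₂` is a conjugacy `s₂ g = q s₁ g q⁻¹` by ONE element
`q = q_x ∈ LocalMp F N T v`** (the chosen lift of the transport `γ_x`; `lineTransportSplitting_apply`).
[cite: MoeglinVignerasWaldspurger1987, Chap. 2 II.1 (B)] -/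
theorem exists_conj_eq_of_lineTransportSplitting_eq {s₁ s₂ : UnitaryGroup.localPi E c N J v →* LocalMp F N T v}
    (h : lineTransportSplitting E v c N hcδ₁ hδ₁ hd₁ hcδ₂ hδ₂ hd₂ x T hT hTd hx s₁ = s₂) :
    ∃ q : LocalMp F N T v, ∀ g, s₂ g = q * s₁ g * q⁻¹ :=
  ⟨lineTransportLift E v c N hcδ₁ hδ₁ hd₁ hcδ₂ hδ₂ hd₂ x T hT hTd hx, fun g => by
    rw [← h, lineTransportSplitting_apply]⟩

end Conj

/-! ## §1 Split place: isomorphic lifts ⇒ the splittings agree after the line transport (conditional on IV-4c4) -/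

/-- **[Liu2021, Lem. D.1 (3)] «⇒» at a SPLIT place, the splitting half, CONDITIONAL on row IV-4c4** (hypothesis
`h4 : rankOne_theta_twist_rigidity_split`, D-0014), READ AT THE TREE'S OBJECTS with the binders of that fact, but for TWO
lines: `F` a number field, `E/F` quadratic, `c`, trace-zero `δ₁, δ₂ ≠ 0` (`c δᵢ = -δᵢ`, `δᵢ² = dᵢ`), `T ∈ M₃(F)` symmetric
with `det T` a unit, `J = T ⊗ 1`, a finite place `v` with `E_v` NOT a field, a Haar measure `μ'` on `F_v`, splittings
`s₁` over `ι_{δ₁}` and `s₂` over `ι_{δ₂}` with `ω_{sᵢ}` smooth and `L²(μ'³)`-isometric, a hermitian line `J₁`, unitary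
continuous characters `χ₁, χ₂` of `U(J₁)(F_v)`.  IF `Θ_{s₁}(χ₁) ≠ 0` and `Θ_{s₁}(χ₁) ≅ Θ_{s₂}(χ₂)` (`AreIsomorphicRep`) THEN
there is a unit `x ∈ E_vˣ` with `δ₁ ⊗ 1 = x xᶜ (δ₂ ⊗ 1)` such that the line transport of `s₂` along `x` (a splitting over
`ι_{δ₁}`) EQUALS `s₁`.  (All lines are equivalent at a split place, `exists_norm_mul_of_not_isField`; the transported
`s₂` is smooth, `L²`-isometric and has `Θ ≅ Θ_{s₂}(χ₂)`, `RankOneThetaLiftLinesEquivalent`; then IV-4c4 on the line `δ₁`.)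
[cite: Liu2021, App. D Lemma D.1 (3) (l. 5233) and proof, split case (l. 5249–5254); Minguez2008, Thm. 1 p. 718] -/
theorem rankOne_theta_split_exists_lineTransportSplitting_eq_of_areIsomorphicRep (h4 : rankOne_theta_twist_rigidity_split)
    (F : Type) [Field F] [NumberField F] (E : Type) [Field E] [NumberField E] [Algebra F E]
    [Algebra.IsQuadraticExtension F E] (c : E ≃ₐ[F] E)
    (δ₁ : E) (hcδ₁ : c δ₁ = -δ₁) (hδ₁ : δ₁ ≠ 0) (d₁ : F) (hd₁ : δ₁ * δ₁ = algebraMap F E d₁)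
    (δ₂ : E) (hcδ₂ : c δ₂ = -δ₂) (hδ₂ : δ₂ ≠ 0) (d₂ : F) (hd₂ : δ₂ * δ₂ = algebraMap F E d₂)
    (T : Matrix (Fin 3) (Fin 3) F) (hT : T.IsSymm) (hTd : IsUnit T.det)
    (J : Matrix (Fin 3) (Fin 3) E) (hJ : J = T.map (algebraMap F E)) (v : HeightOneSpectrum (𝓞 F))
    (hE : ¬ IsField (UnitaryGroup.LocalRing E v))
    [MeasurableSpace (v.adicCompletion F)] [BorelSpace (v.adicCompletion F)]
    (μ' : Measure (v.adicCompletion F)) [μ'.IsAddHaarMeasure]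
    (s₁ s₂ : UnitaryGroup.localPi E c 3 J v →* LocalMp F 3 T v)
    (hs₁ : ∀ g, MpPsi.proj _ (s₁ g) = iota F E c 3 hcδ₁ hδ₁ hd₁ T hT hJ v g)
    (hs₂ : ∀ g, MpPsi.proj _ (s₂ g) = iota F E c 3 hcδ₂ hδ₂ hd₂ T hT hJ v g)
    (hsm₁ : Representation.IsSmooth ((MpPsi.toRep (localSchrodinger F 3 T v)).comp s₁))
    (hsm₂ : Representation.IsSmooth ((MpPsi.toRep (localSchrodinger F 3 T v)).comp s₂))
    (hL2₁ : Representation.IsL2Isometric (Measure.pi fun _ : Fin 3 => μ')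
      ((MpPsi.toRep (localSchrodinger F 3 T v)).comp s₁))
    (hL2₂ : Representation.IsL2Isometric (Measure.pi fun _ : Fin 3 => μ')
      ((MpPsi.toRep (localSchrodinger F 3 T v)).comp s₂))
    (J₁ : Matrix (Fin 1) (Fin 1) E) (hJ₁ : J₁ 0 0 ≠ 0) (χ₁ χ₂ : UnitaryGroup.localPi E c 1 J₁ v →* ℂˣ)
    (hχ₁u : ∀ z, ‖((χ₁ z : ℂˣ) : ℂ)‖ = 1) (hχ₁c : Continuous fun z => ((χ₁ z : ℂˣ) : ℂ))
    (hχ₂u : ∀ z, ‖((χ₂ z : ℂˣ) : ℂ)‖ = 1) (hχ₂c : Continuous fun z => ((χ₂ z : ℂˣ) : ℂ))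
    (hnt : Nontrivial (TwistedCoinv.Coinv
      ((show Representation ℂ (UnitaryGroup.localPi E c 1 J₁ v) (SchwartzBruhat (Fin 3 → v.adicCompletion F)) from
        ((MpPsi.toRep (localSchrodinger F 3 T v)).comp s₁).comp (UnitaryGroup.localCenter E c 3 J J₁ hJ₁ v))) χ₁))
    (hiso : AreIsomorphicRep
      (TwistedCoinv.rep
        (ρW := show Representation ℂ (UnitaryGroup.localPi E c 1 J₁ v) (SchwartzBruhat (Fin 3 → v.adicCompletion F)) from
          ((MpPsi.toRep (localSchrodinger F 3 T v)).comp s₁).comp (UnitaryGroup.localCenter E c 3 J J₁ hJ₁ v))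
        χ₁ ((MpPsi.toRep (localSchrodinger F 3 T v)).comp s₁)
        (fun g z => (show Commute g (UnitaryGroup.localCenter E c 3 J J₁ hJ₁ v z) from
          UnitaryGroup.localCenter_comm E c 3 J J₁ hJ₁ v z g).map ((MpPsi.toRep (localSchrodinger F 3 T v)).comp s₁)))
      (TwistedCoinv.rep
        (ρW := show Representation ℂ (UnitaryGroup.localPi E c 1 J₁ v) (SchwartzBruhat (Fin 3 → v.adicCompletion F)) from
          ((MpPsi.toRep (localSchrodinger F 3 T v)).comp s₂).comp (UnitaryGroup.localCenter E c 3 J J₁ hJ₁ v))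
        χ₂ ((MpPsi.toRep (localSchrodinger F 3 T v)).comp s₂)
        (fun g z => (show Commute g (UnitaryGroup.localCenter E c 3 J J₁ hJ₁ v z) from
          UnitaryGroup.localCenter_comm E c 3 J J₁ hJ₁ v z g).map ((MpPsi.toRep (localSchrodinger F 3 T v)).comp s₂)))) :
    ∃ (x : (LocalRing E v)ˣ) (hx : algebraMap E (LocalRing E v) δ₁ =
        (x : LocalRing E v) * conjLocal E c v x * algebraMap E (LocalRing E v) δ₂),
      lineTransportSplitting E v c 3 hcδ₂ hδ₂ hd₂ hcδ₁ hδ₁ hd₁ x T hT hTd hx s₂ = s₁ := by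
  -- all lines are in one class at a split place: `δ₁ ⊗ 1 = x xᶜ (δ₂ ⊗ 1)`
  obtain ⟨x, hx⟩ := exists_norm_mul_of_not_isField E v c hcδ₂ hδ₂ hcδ₁ hδ₁ hE
  refine ⟨x, hx, ?_⟩
  -- row IV-4c4 on the line `δ₁`, for `s₁` and the transported `s₂`
  symm
  refine h4 F E c δ₁ hcδ₁ hδ₁ d₁ hd₁ T hT hTd J hJ v hE μ' s₁
    (lineTransportSplitting E v c 3 hcδ₂ hδ₂ hd₂ hcδ₁ hδ₁ hd₁ x T hT hTd hx s₂) hs₁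
    (proj_lineTransportSplitting E v c 3 hcδ₂ hδ₂ hd₂ hcδ₁ hδ₁ hd₁ x T hT hTd hJ hx s₂ hs₂) hsm₁
    (isSmooth_lineTransportSplitting E v c 3 hcδ₂ hδ₂ hd₂ hcδ₁ hδ₁ hd₁ x T hT hTd hx s₂ hsm₂) hL2₁
    (isL2Isometric_lineTransportSplitting E v c 3 hcδ₂ hδ₂ hd₂ hcδ₁ hδ₁ hd₁ x T hT hTd hx μ' s₂ hL2₂)
    J₁ hJ₁ χ₁ χ₂ hχ₁u hχ₁c hχ₂u hχ₂c hnt ?_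
  exact hiso.trans
    (areIsomorphicRep_theta_lineTransportSplitting E v c 3 hcδ₂ hδ₂ hd₂ hcδ₁ hδ₁ hd₁ T hT hTd x hx s₂ J₁ hJ₁ χ₂)

/-! ## §2 … and the centre characters agree -/

/-- **[Liu2021, Lem. D.1 (3)] «⇒» at a SPLIT place, splitting AND `χ`, CONDITIONAL on row IV-4c4**: under the
hypotheses of `rankOne_theta_split_exists_lineTransportSplitting_eq_of_areIsomorphicRep`, (i) `s₁` is the line transport
of `s₂` along some `x` with `δ₁ ⊗ 1 = x xᶜ (δ₂ ⊗ 1)`, and (ii) `χ₁ = χ₂` (central characters,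
`rankOne_thetaChar_eq_of_areIsomorphicRep₂`, unconditional).  The `μ ∧ χ` third of (3) at a split place follows once the
transported equality of χ-splittings is read as `μ₁ = μ₂` (Kudla's explicit sections) — not done here.
[cite: Liu2021, App. D Lemma D.1 (3) (l. 5233) and proof, split case (l. 5249–5254); Minguez2008, Thm. 1 p. 718] -/
theorem rankOne_theta_split_lineTransport_eq_and_char_eq_of_areIsomorphicRep (h4 : rankOne_theta_twist_rigidity_split)
    (F : Type) [Field F] [NumberField F] (E : Type) [Field E] [NumberField E] [Algebra F E]
    [Algebra.IsQuadraticExtension F E] (c : E ≃ₐ[F] E)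
    (δ₁ : E) (hcδ₁ : c δ₁ = -δ₁) (hδ₁ : δ₁ ≠ 0) (d₁ : F) (hd₁ : δ₁ * δ₁ = algebraMap F E d₁)
    (δ₂ : E) (hcδ₂ : c δ₂ = -δ₂) (hδ₂ : δ₂ ≠ 0) (d₂ : F) (hd₂ : δ₂ * δ₂ = algebraMap F E d₂)
    (T : Matrix (Fin 3) (Fin 3) F) (hT : T.IsSymm) (hTd : IsUnit T.det)
    (J : Matrix (Fin 3) (Fin 3) E) (hJ : J = T.map (algebraMap F E)) (v : HeightOneSpectrum (𝓞 F))
    (hE : ¬ IsField (UnitaryGroup.LocalRing E v))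
    [MeasurableSpace (v.adicCompletion F)] [BorelSpace (v.adicCompletion F)]
    (μ' : Measure (v.adicCompletion F)) [μ'.IsAddHaarMeasure]
    (s₁ s₂ : UnitaryGroup.localPi E c 3 J v →* LocalMp F 3 T v)
    (hs₁ : ∀ g, MpPsi.proj _ (s₁ g) = iota F E c 3 hcδ₁ hδ₁ hd₁ T hT hJ v g)
    (hs₂ : ∀ g, MpPsi.proj _ (s₂ g) = iota F E c 3 hcδ₂ hδ₂ hd₂ T hT hJ v g)
    (hsm₁ : Representation.IsSmooth ((MpPsi.toRep (localSchrodinger F 3 T v)).comp s₁))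
    (hsm₂ : Representation.IsSmooth ((MpPsi.toRep (localSchrodinger F 3 T v)).comp s₂))
    (hL2₁ : Representation.IsL2Isometric (Measure.pi fun _ : Fin 3 => μ')
      ((MpPsi.toRep (localSchrodinger F 3 T v)).comp s₁))
    (hL2₂ : Representation.IsL2Isometric (Measure.pi fun _ : Fin 3 => μ')
      ((MpPsi.toRep (localSchrodinger F 3 T v)).comp s₂))
    (J₁ : Matrix (Fin 1) (Fin 1) E) (hJ₁ : J₁ 0 0 ≠ 0) (χ₁ χ₂ : UnitaryGroup.localPi E c 1 J₁ v →* ℂˣ)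
    (hχ₁u : ∀ z, ‖((χ₁ z : ℂˣ) : ℂ)‖ = 1) (hχ₁c : Continuous fun z => ((χ₁ z : ℂˣ) : ℂ))
    (hχ₂u : ∀ z, ‖((χ₂ z : ℂˣ) : ℂ)‖ = 1) (hχ₂c : Continuous fun z => ((χ₂ z : ℂˣ) : ℂ))
    (hnt : Nontrivial (TwistedCoinv.Coinv
      ((show Representation ℂ (UnitaryGroup.localPi E c 1 J₁ v) (SchwartzBruhat (Fin 3 → v.adicCompletion F)) from
        ((MpPsi.toRep (localSchrodinger F 3 T v)).comp s₁).comp (UnitaryGroup.localCenter E c 3 J J₁ hJ₁ v))) χ₁))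
    (hiso : AreIsomorphicRep
      (TwistedCoinv.rep
        (ρW := show Representation ℂ (UnitaryGroup.localPi E c 1 J₁ v) (SchwartzBruhat (Fin 3 → v.adicCompletion F)) from
          ((MpPsi.toRep (localSchrodinger F 3 T v)).comp s₁).comp (UnitaryGroup.localCenter E c 3 J J₁ hJ₁ v))
        χ₁ ((MpPsi.toRep (localSchrodinger F 3 T v)).comp s₁)
        (fun g z => (show Commute g (UnitaryGroup.localCenter E c 3 J J₁ hJ₁ v z) from
          UnitaryGroup.localCenter_comm E c 3 J J₁ hJ₁ v z g).map ((MpPsi.toRep (localSchrodinger F 3 T v)).comp s₁)))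
      (TwistedCoinv.rep
        (ρW := show Representation ℂ (UnitaryGroup.localPi E c 1 J₁ v) (SchwartzBruhat (Fin 3 → v.adicCompletion F)) from
          ((MpPsi.toRep (localSchrodinger F 3 T v)).comp s₂).comp (UnitaryGroup.localCenter E c 3 J J₁ hJ₁ v))
        χ₂ ((MpPsi.toRep (localSchrodinger F 3 T v)).comp s₂)
        (fun g z => (show Commute g (UnitaryGroup.localCenter E c 3 J J₁ hJ₁ v z) from
          UnitaryGroup.localCenter_comm E c 3 J J₁ hJ₁ v z g).map ((MpPsi.toRep (localSchrodinger F 3 T v)).comp s₂)))) :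
    (∃ (x : (LocalRing E v)ˣ) (hx : algebraMap E (LocalRing E v) δ₁ =
        (x : LocalRing E v) * conjLocal E c v x * algebraMap E (LocalRing E v) δ₂),
      lineTransportSplitting E v c 3 hcδ₂ hδ₂ hd₂ hcδ₁ hδ₁ hd₁ x T hT hTd hx s₂ = s₁) ∧ χ₁ = χ₂ :=
  ⟨rankOne_theta_split_exists_lineTransportSplitting_eq_of_areIsomorphicRep h4 F E c δ₁ hcδ₁ hδ₁ d₁ hd₁ δ₂ hcδ₂ hδ₂
      d₂ hd₂ T hT hTd J hJ v hE μ' s₁ s₂ hs₁ hs₂ hsm₁ hsm₂ hL2₁ hL2₂ J₁ hJ₁ χ₁ χ₂ hχ₁u hχ₁c hχ₂u hχ₂c hnt hiso,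
    rankOne_thetaChar_eq_of_areIsomorphicRep₂ F E c 3 T J v s₁ s₂ J₁ hJ₁ χ₁ χ₂ hnt hiso⟩

end Literature.RepresentationTheory.MoeglinVignerasWaldspurger1987

end
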